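import Literature.Probability.Percolation.AdjDihedral
import Literature.Probability.Percolation.ArmSeparationOutMoveFour
import HarnessLib

/-!
# Fenced exits (fenced arms without the tip path) and their landing move in rotated frames

Topic `Literature/Probability/Percolation`; family `crit-perc` / near-critical percolation on `𝕋`.
A brick of the near-critical arm-separation theorem for four arms in the ADJACENT colour
arrangement (P. Nolin, EJP 13 (2008), Thm. 11, `j = 4`, `σ = BBWW` [arXiv 0711.4948: Thm. 10];
the input `hsepAdj` of `Werner2009_lemma63_of_altSeparation_of_adjSeparation`).

For two arms of the same colour the exit of an arm is the fence of a TERM of the lowest-crossing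
exploration reached by a clean route (`PairData.exists_two_clean_routes`, `TrapPairContract.lean`),
not the fence of the arm's own final crossing: the route `a ⇝ m` need not pass through the tip `z`
of that term. All the landing machinery of the tree for fenced outer arms (`TrapFencedArm`,
`ArmSeparationOuter.lean`; the hook `trapArm_to_entry`, `ArmSeparationExtSpoke.lean`; the glue
`out_landing_glue(_two)`, `ArmSeparationOutMove(Four).lean`) uses of the arm only its start `a`,
its fence site `m`, the corner crossing through `m`, the path `a ⇝ m` and the tip `z` as a
geometric datum — never the field `path_tip`. This file records the weaker structure and the
landing move for it, with the exit read through a ROTATION `ρ^i` (so that all six readings are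
rotations, as needed when the target sides are rotated):

* `TrapFencedExit M n k₀ K χ` — `TrapFencedArm` without `path_tip`; `TrapFencedArm.toExit`;
* `TrapExit M n k₀ K χ` — the general form: the route may use the wider zone `trapExitZone` of the
  nominal tip (square extended `4k` rows up), so that a fence FROM ABOVE (`TermFenceUp`, whose corner
  box lies below its tip `z⁺`) is an exit with nominal tip `z⁺ - 3k e₁`; `TrapFencedExit.toTrapExit`;
* `trapExit_to_entry` — the hook of `trapArm_to_entry` for an exit of `rotConfig i ω`
  (corner crossing catches the spoke `extSpokeTube`, the spoke meets the entry tube: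
  `spoke_junctionRot`);
* `rot_exit_landing_move_row'`, `rot_exit_landing_move_two'` — **the landing move of an exit
  read through `ρ^i`, to the right side and to the top side of `∂Λ_{4M}`** at a middle target row
  (as `out_landing_move_row/_two`, with the rotation hook): `ω ∈ extOpenArm n (4M)`, resp.
  `frameConfig 2 ω ∈ extOpenArm n (4M)`; `rot_exit_landing_move_row/_two` the same for fenced exits.

Everything here is proved; no named facts are introduced.

## References

* P. Nolin, Near-critical percolation in two dimensions, *Electron. J. Probab.* 13 (2008), §4.3
  Prop. 12 (proof), §4.4 (arXiv 0711.4948: Prop. 11; proof of Thm. 10, p. 12) [Nolin2008].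
* H. Kesten, Scaling relations for 2D-percolation, *Comm. Math. Phys.* 109 (1987), Lemma 4 [Kesten1987].

Tree: `TrapFencedArm`, `TrapTipOK`, `trapFrameZone`, `trapO_coord`; `extSpokeTube`, `extSpokeEvent`,
`SpokeMeetsRot`, `pathIn_of_rotConfig_open` (`ArmSeparationExtSpoke.lean`); `spoke_junctionRot`
(`AdjDihedral.lean`); `out_landing_glue`, `otgtV` (`ArmSeparationOutMove.lean`); `out_landing_glue_two`,
`tgtRow_facts`, `Tube.swap` (`ArmSeparationOutMoveFour.lean`); `arc`, `thinRing`, `vchunks`,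
`isChain_arc_thinRing`, `exists_crossings`, `mem_of_mem_arc`, `triNorm_mem_of_mem_thinRing`,
`exists_mem_of_cross`, `triNorm_rot`.
-/

noncomputable section

open Set

namespace Literature.Probability.Percolation

open LatticeModels Tube

/-! ### Fenced exits -/

/-- **The zone of an exit**: the square of half-width `2k + 1` about the nominal tip `z`, extended by
`4k` rows upwards, inside the trapezoid or outside `Λ_{2M}`. It contains the fence zone
`trapFrameZone M z k` of a fence from below with tip `z` (`trapFrameZone_subset_trapExitZone`) and the
connection of a fence from above with tip `z + 3k e₁` (square about that tip), so that exits through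
fences of both explorations are `TrapFencedExit`s. [folklore] -/
def trapExitZone (M : ℕ) (z : Site 2) (k : ℕ) : Set (Site 2) :=
  {v | (v ∈ trapD M ∨ 2 * (M : ℤ) < triNorm v) ∧
    z 0 - (2 * k + 1) ≤ v 0 ∧ v 0 ≤ z 0 + (2 * k + 1) ∧ z 1 - (2 * k + 1) ≤ v 1 ∧ v 1 ≤ z 1 + (6 * k + 1)}

/-- Membership in the zone of an exit, unfolded. [folklore] -/
theorem mem_trapExitZone {M k : ℕ} {z v : Site 2} :
    v ∈ trapExitZone M z k ↔ (v ∈ trapD M ∨ 2 * (M : ℤ) < triNorm v) ∧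
      z 0 - (2 * k + 1) ≤ v 0 ∧ v 0 ≤ z 0 + (2 * k + 1) ∧ z 1 - (2 * k + 1) ≤ v 1 ∧ v 1 ≤ z 1 + (6 * k + 1) :=
  Iff.rfl

/-- The fence zone of a fence from below lies in the zone of the exit with the same tip. [folklore] -/
theorem trapFrameZone_subset_trapExitZone {M k : ℕ} {z : Site 2} : trapFrameZone M z k ⊆ trapExitZone M z k := by
  intro v hv
  rw [mem_trapFrameZone] at hv
  refine ⟨hv.1.imp_right fun h => h.1, hv.2.1, hv.2.2.1, hv.2.2.2.1, ?_⟩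
  have := hv.2.2.2.2
  have hk : (0 : ℤ) ≤ k := by positivity
  omega

/-- Monotonicity of the region of the routes. [folklore] -/
theorem exitRegion_mono {M n k : ℕ} {z : Site 2} {χ : SiteConfig (Site 2)} :
    (triAnnSet n (2 * M) ∪ trapFrameZone M z k) ∩ (χ : Set (Site 2)) ⊆ (triAnnSet n (2 * M) ∪ trapExitZone M z k) ∩ χ :=
  Set.inter_subset_inter_left _ (Set.union_subset_union_right _ trapFrameZone_subset_trapExitZone)

/-- **A fenced exit** behind side `0` of `∂Λ_{2M}` in the configuration `χ`: a tip `z ∈ trapO M`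
fenced at the scale `k = k₀ · 32^j` (an open vertical crossing of the corner box
`[z₀+k, z₀+2k] × [z₁+k, z₁+2k]` through `m`), and an open route from a site `a` of norm `n` to `m`
inside the annulus `{n ≤ |v| ≤ 2M}` and the fence zone — `TrapFencedArm` without the path from `a`
to the tip and without the protection clause of `TrapTipOK` (neither is used by the landing move;
dropping the protection makes the structure monotone under restriction of the configuration to a
set containing the route and the corner box, `TrapFencedExit.restrict`). [cite: Nolin2008, §4.2 Def. 6–8 and §4.4 (arXiv 0711.4948: Def. 6–8, Lemma 14)] -/
structure TrapFencedExit (M n k₀ K : ℕ) (χ : SiteConfig (Site 2)) where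
  /-- the tip -/
  z : Site 2
  /-- the scale index -/
  j : ℕ
  /-- the site of the fence through which the vertical crossing passes -/
  m : Site 2
  /-- the start of the route, a site of norm `n` -/
  a : Site 2
  z_mem : z ∈ trapO M
  j_lt : j < K
  norm_a : triNorm a = n
  vcross : OpenVCrossThrough (triStrip (z 0 + trapScale k₀ j) (z 1 + trapScale k₀ j) (trapScale k₀ j) (trapScale k₀ j))
    (z 1 + trapScale k₀ j) (z 1 + 2 * trapScale k₀ j) χ m
  path : PathIn triGraph ((triAnnSet n (2 * M) ∪ trapFrameZone M z (trapScale k₀ j)) ∩ χ) a m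

namespace TrapFencedExit

variable {M n k₀ K : ℕ} {χ : SiteConfig (Site 2)}

/-- The scale of a fenced exit. [folklore] -/
def k (F : TrapFencedExit M n k₀ K χ) : ℕ := trapScale k₀ F.j

/-- **Restriction**: a fenced exit of `χ` whose route is a path inside `S ⊆ P` (and the corner box
inside `P`) is a fenced exit of `χ ∩ P`. [folklore] -/
def restrict (F : TrapFencedExit M n k₀ K χ) {S P : Set (Site 2)} (hP : PathIn triGraph S F.a F.m)
    (hS : S ⊆ (triAnnSet n (2 * M) ∪ trapFrameZone M F.z F.k) ∩ χ) (hSP : S ⊆ P)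
    (hbox : triStrip (F.z 0 + F.k) (F.z 1 + F.k) F.k F.k ⊆ P) : TrapFencedExit M n k₀ K (χ ∩ P) where
  z := F.z
  j := F.j
  m := F.m
  a := F.a
  z_mem := F.z_mem
  j_lt := F.j_lt
  norm_a := F.norm_a
  vcross := by
    obtain ⟨b, t, hb, ht, Pb, Pt⟩ := F.vcross
    exact ⟨b, t, hb, ht, Pb.mono fun v hv => ⟨hv.1, hv.2, hbox hv.1⟩, Pt.mono fun v hv => ⟨hv.1, hv.2, hbox hv.1⟩⟩
  path := hP.mono fun v hv => ⟨(hS hv).1, (hS hv).2, hSP hv⟩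

/-- Restriction keeps the tip. [folklore] -/
@[simp] theorem restrict_z (F : TrapFencedExit M n k₀ K χ) {S P : Set (Site 2)} (hP : PathIn triGraph S F.a F.m)
    (hS : S ⊆ (triAnnSet n (2 * M) ∪ trapFrameZone M F.z F.k) ∩ χ) (hSP : S ⊆ P)
    (hbox : triStrip (F.z 0 + F.k) (F.z 1 + F.k) F.k F.k ⊆ P) : (F.restrict hP hS hSP hbox).z = F.z := rfl

/-- Restriction keeps the scale. [folklore] -/
@[simp] theorem restrict_k (F : TrapFencedExit M n k₀ K χ) {S P : Set (Site 2)} (hP : PathIn triGraph S F.a F.m)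
    (hS : S ⊆ (triAnnSet n (2 * M) ∪ trapFrameZone M F.z F.k) ∩ χ) (hSP : S ⊆ P)
    (hbox : triStrip (F.z 0 + F.k) (F.z 1 + F.k) F.k F.k ⊆ P) : (F.restrict hP hS hSP hbox).k = F.k := rfl

/-- Restriction keeps the start. [folklore] -/
@[simp] theorem restrict_a (F : TrapFencedExit M n k₀ K χ) {S P : Set (Site 2)} (hP : PathIn triGraph S F.a F.m)
    (hS : S ⊆ (triAnnSet n (2 * M) ∪ trapFrameZone M F.z F.k) ∩ χ) (hSP : S ⊆ P)
    (hbox : triStrip (F.z 0 + F.k) (F.z 1 + F.k) F.k F.k ⊆ P) : (F.restrict hP hS hSP hbox).a = F.a := rfl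

end TrapFencedExit

/-- A fenced arm is a fenced exit. [folklore] -/
def TrapFencedArm.toExit {M n k₀ K : ℕ} {χ : SiteConfig (Site 2)} (F : TrapFencedArm M n k₀ K χ) :
    TrapFencedExit M n k₀ K χ :=
  ⟨F.z, F.j, F.m, F.a, F.z_mem, F.j_lt, F.norm_a, F.tipOK.1, F.path⟩

/-- `toExit` keeps the scale. [folklore] -/
@[simp] theorem TrapFencedArm.toExit_k {M n k₀ K : ℕ} {χ : SiteConfig (Site 2)} (F : TrapFencedArm M n k₀ K χ) :
    F.toExit.k = F.k := rfl

/-! ### Exits with the wide zone -/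

/-- **An exit** (the general form of a fenced exit): as `TrapFencedExit`, the route being allowed in
the wider zone `trapExitZone` of the nominal tip — so that a fence FROM ABOVE (`TermFenceUp`, corner
box below its tip `z⁺`) is an exit with nominal tip `z = z⁺ - 3k e₁`. The landing moves below are
proved for exits; a fenced exit is an exit (`TrapFencedExit.toTrapExit`). [cite: Nolin2008, §4.2 Def. 6–8 and §4.4 (arXiv 0711.4948: Def. 6–8, Lemma 14)] -/
structure TrapExit (M n k₀ K : ℕ) (χ : SiteConfig (Site 2)) where
  /-- the nominal tip -/
  z : Site 2
  /-- the scale index -/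
  j : ℕ
  /-- the site of the fence through which the vertical crossing passes -/
  m : Site 2
  /-- the start of the route, a site of norm `n` -/
  a : Site 2
  z_mem : z ∈ trapO M
  j_lt : j < K
  norm_a : triNorm a = n
  vcross : OpenVCrossThrough (triStrip (z 0 + trapScale k₀ j) (z 1 + trapScale k₀ j) (trapScale k₀ j) (trapScale k₀ j))
    (z 1 + trapScale k₀ j) (z 1 + 2 * trapScale k₀ j) χ m
  path : PathIn triGraph ((triAnnSet n (2 * M) ∪ trapExitZone M z (trapScale k₀ j)) ∩ χ) a m

namespace TrapExit

variable {M n k₀ K : ℕ} {χ : SiteConfig (Site 2)}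

/-- The scale of an exit. [folklore] -/
def k (F : TrapExit M n k₀ K χ) : ℕ := trapScale k₀ F.j

/-- **Restriction**: an exit of `χ` whose route is a path inside `S ⊆ P` (and the corner box inside `P`)
is an exit of `χ ∩ P`. [folklore] -/
def restrict (F : TrapExit M n k₀ K χ) {S P : Set (Site 2)} (hP : PathIn triGraph S F.a F.m)
    (hS : S ⊆ (triAnnSet n (2 * M) ∪ trapExitZone M F.z F.k) ∩ χ) (hSP : S ⊆ P)
    (hbox : triStrip (F.z 0 + F.k) (F.z 1 + F.k) F.k F.k ⊆ P) : TrapExit M n k₀ K (χ ∩ P) where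
  z := F.z
  j := F.j
  m := F.m
  a := F.a
  z_mem := F.z_mem
  j_lt := F.j_lt
  norm_a := F.norm_a
  vcross := by
    obtain ⟨b, t, hb, ht, Pb, Pt⟩ := F.vcross
    exact ⟨b, t, hb, ht, Pb.mono fun v hv => ⟨hv.1, hv.2, hbox hv.1⟩, Pt.mono fun v hv => ⟨hv.1, hv.2, hbox hv.1⟩⟩
  path := hP.mono fun v hv => ⟨(hS hv).1, (hS hv).2, hSP hv⟩

/-- Restriction keeps the tip. [folklore] -/
@[simp] theorem restrict_z (F : TrapExit M n k₀ K χ) {S P : Set (Site 2)} (hP : PathIn triGraph S F.a F.m)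
    (hS : S ⊆ (triAnnSet n (2 * M) ∪ trapExitZone M F.z F.k) ∩ χ) (hSP : S ⊆ P)
    (hbox : triStrip (F.z 0 + F.k) (F.z 1 + F.k) F.k F.k ⊆ P) : (F.restrict hP hS hSP hbox).z = F.z := rfl

/-- Restriction keeps the scale. [folklore] -/
@[simp] theorem restrict_k (F : TrapExit M n k₀ K χ) {S P : Set (Site 2)} (hP : PathIn triGraph S F.a F.m)
    (hS : S ⊆ (triAnnSet n (2 * M) ∪ trapExitZone M F.z F.k) ∩ χ) (hSP : S ⊆ P)
    (hbox : triStrip (F.z 0 + F.k) (F.z 1 + F.k) F.k F.k ⊆ P) : (F.restrict hP hS hSP hbox).k = F.k := rfl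

/-- Restriction keeps the start. [folklore] -/
@[simp] theorem restrict_a (F : TrapExit M n k₀ K χ) {S P : Set (Site 2)} (hP : PathIn triGraph S F.a F.m)
    (hS : S ⊆ (triAnnSet n (2 * M) ∪ trapExitZone M F.z F.k) ∩ χ) (hSP : S ⊆ P)
    (hbox : triStrip (F.z 0 + F.k) (F.z 1 + F.k) F.k F.k ⊆ P) : (F.restrict hP hS hSP hbox).a = F.a := rfl

end TrapExit

/-- A fenced exit is an exit. [folklore] -/
def TrapFencedExit.toTrapExit {M n k₀ K : ℕ} {χ : SiteConfig (Site 2)} (F : TrapFencedExit M n k₀ K χ) :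
    TrapExit M n k₀ K χ :=
  ⟨F.z, F.j, F.m, F.a, F.z_mem, F.j_lt, F.norm_a, F.vcross, F.path.mono exitRegion_mono⟩

/-- `toTrapExit` keeps the tip. [folklore] -/
@[simp] theorem TrapFencedExit.toTrapExit_z {M n k₀ K : ℕ} {χ : SiteConfig (Site 2)} (F : TrapFencedExit M n k₀ K χ) :
    F.toTrapExit.z = F.z := rfl

/-- `toTrapExit` keeps the scale. [folklore] -/
@[simp] theorem TrapFencedExit.toTrapExit_k {M n k₀ K : ℕ} {χ : SiteConfig (Site 2)} (F : TrapFencedExit M n k₀ K χ) :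
    F.toTrapExit.k = F.k := rfl

/-- `toTrapExit` keeps the start. [folklore] -/
@[simp] theorem TrapFencedExit.toTrapExit_a {M n k₀ K : ℕ} {χ : SiteConfig (Site 2)} (F : TrapFencedExit M n k₀ K χ) :
    F.toTrapExit.a = F.a := rfl

/-- `toTrapExit` keeps the fence site. [folklore] -/
@[simp] theorem TrapFencedExit.toTrapExit_m {M n k₀ K : ℕ} {χ : SiteConfig (Site 2)} (F : TrapFencedExit M n k₀ K χ) :
    F.toTrapExit.m = F.m := rfl

/-! ### The hook -/

/-- **From the exit to the entry tube** (`trapArm_to_entry` for an exit). Let `F` be an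
exit of `rotConfig i ω`, its tip in the window `[T₀, T₀+w)`, the spoke crossed
(`extSpokeEvent i`), and `E` a tube of the original frame crossed from `xE` to `yE` with
`SpokeMeetsRot i`. Then `ρ^i F.a` is joined to `xE` by an open path of
`ρ^i(spoke box ∪ annulus ∪ zone ∪ corner box) ∪ E.box`. [cite: Nolin2008, §4.3 Prop. 12 (proof) and §4.4 (arXiv 0711.4948: Prop. 11, Thm. 10)] -/
theorem trapExit_to_entry {M n k₀ K : ℕ} {i : ℕ} (hi : i < 6) {ω : SiteConfig (Site 2)}
    (F : TrapExit M n k₀ K (rotConfig i ω)) {T₀ : ℤ} {w : ℕ} (hwin : T₀ ≤ F.z 1 ∧ F.z 1 < T₀ + w)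
    {L ε : ℕ} (hfit : (w : ℤ) + (F.k / 4 : ℕ) + 2 * ε ≤ F.k) (hL : F.k + 1 ≤ L)
    (hSp : ω ∈ extSpokeEvent i M F.k T₀ w L ε)
    {E : Tube} {xE yE : Site 2} (hE : E.IsCrossing ω xE yE) (hJ : SpokeMeetsRot i (extSpokeTube M F.k T₀ w L ε) E) :
    PathIn triGraph ((triRotIsoPow i '' ((extSpokeTube M F.k T₀ w L ε).box ∪
        (triAnnSet n (2 * M) ∪ trapExitZone M F.z F.k ∪ triStrip (F.z 0 + F.k) (F.z 1 + F.k) F.k F.k)) ∪ E.box) ∩ ω)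
      (triRotIsoPow i F.a) xE := by
  obtain ⟨Sp, hSp'⟩ : ∃ Sp : Tube, Sp = extSpokeTube M F.k T₀ w L ε := ⟨_, rfl⟩
  have hSa : Sp.a = 2 * (M : ℤ) + F.k := by rw [hSp']; rfl
  have hSb : Sp.b = T₀ + w + F.k + (F.k / 4 : ℕ) := by rw [hSp']; rfl
  have hSw : Sp.w = L := by rw [hSp']; rfl
  have hSh : Sp.h = 2 * ε := by rw [hSp']; rfl
  have hShz : Sp.horiz = true := by rw [hSp']; rfl
  have hSp2 : rotConfig i ω ∈ Sp.event := by rw [hSp']; exact hSp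
  rw [← hSp'] at hJ ⊢
  obtain ⟨hz0, hz1, hz1'⟩ := trapO_coord F.z_mem
  have hL' : (F.k : ℤ) + 1 ≤ L := by exact_mod_cast hL
  -- (1) the crossing of the spoke in the frame
  obtain ⟨x', y', hcr⟩ := Sp.exists_isCrossing hSp2
  have hs' : x' 0 = Sp.a ∧ y' 0 = Sp.a + Sp.w := by
    have hs := hcr.1
    rw [hShz] at hs
    simpa using hs
  have P' := hcr.2
  obtain ⟨SH, hSH, PH, TH⟩ := P'.exists_support
  have hSHb : ∀ v ∈ SH, Sp.a ≤ v 0 ∧ v 0 ≤ Sp.a + Sp.w ∧ Sp.b ≤ v 1 ∧ v 1 ≤ Sp.b + Sp.h := fun v hv =>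
    (Tube.mem_box Sp).1 (hSH hv).1
  -- (2) the corner crossing catches the spoke (frame coordinates)
  obtain ⟨b, t, hb1, ht1, Pb, Pt⟩ := F.vcross
  obtain ⟨S₁, hS₁, PS₁, TS₁⟩ := Pb.symm.exists_support
  obtain ⟨S₂, hS₂, PS₂, TS₂⟩ := Pt.exists_support
  have PV : PathIn triGraph (S₁ ∪ S₂) b t := (PS₁.symm.mono subset_union_left).trans (PS₂.mono subset_union_right)
  have hSVb : ∀ v ∈ S₁ ∪ S₂, F.z 0 + F.k ≤ v 0 ∧ v 0 ≤ F.z 0 + F.k + F.k ∧ F.z 1 + F.k ≤ v 1 ∧ v 1 ≤ F.z 1 + F.k + F.k := by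
    rintro v (hv | hv)
    · exact (mem_triStrip.1 (hS₁ hv).1)
    · exact (mem_triStrip.1 (hS₂ hv).1)
  have hk : ((trapScale k₀ F.j : ℕ) : ℤ) = F.k := rfl
  obtain ⟨u, huH, huV⟩ := exists_mem_of_cross (L := F.z 0 + F.k) (R := F.z 0 + 2 * F.k) (B := F.z 1 + F.k) (T := F.z 1 + 2 * F.k)
    (by omega) (by omega) PH (by rw [hs'.1, hSa]; omega) (by rw [hs'.2, hSa, hSw]; omega)
    (fun v hv _ _ => by have := hSHb v hv; omega)
    PV (by rw [hk] at hb1; omega) (by rw [hk] at ht1; omega) (fun v hv _ _ => by have := hSVb v hv; omega)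
  -- from `m` to `u` inside the corner box, then back along the spoke to its start `x'`
  have Pmu : PathIn triGraph (triStrip (F.z 0 + F.k) (F.z 1 + F.k) F.k F.k ∩ rotConfig i ω) F.m u := by
    rcases huV with hu | hu
    · exact (TS₁ u hu).mono hS₁
    · exact (TS₂ u hu).mono hS₂
  have Pux : PathIn triGraph (Sp.box ∩ rotConfig i ω) u x' := (TH u huH).symm.mono hSH
  have Pframe : PathIn triGraph ((Sp.box ∪ (triAnnSet n (2 * M) ∪ trapExitZone M F.z F.k ∪ triStrip (F.z 0 + F.k) (F.z 1 + F.k) F.k F.k)) ∩ rotConfig i ω) F.a x' := by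
    refine ((F.path.mono ?_).trans (Pmu.mono ?_)).trans (Pux.mono ?_)
    · rintro v ⟨hv, hvχ⟩; exact ⟨Or.inr (Or.inl hv), hvχ⟩
    · rintro v ⟨hv, hvχ⟩; exact ⟨Or.inr (Or.inr hv), hvχ⟩
    · rintro v ⟨hv, hvχ⟩; exact ⟨Or.inl hv, hvχ⟩
  -- (3) read in the original frame, then the junction with `E`
  have Pphys := pathIn_of_rotConfig_open i Pframe
  have Q := spoke_junctionRot hi hShz hcr hE hJ
  refine PathIn.trans (Pphys.mono fun v hv => ⟨Or.inl hv.1, hv.2⟩) (Q.mono ?_)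
  rintro v ⟨hv | hv, hvω⟩
  · obtain ⟨q, hq, rfl⟩ := hv
    exact ⟨Or.inl ⟨q, Or.inl hq, rfl⟩, hvω⟩
  · exact ⟨Or.inr hv, hvω⟩

/-! ### The landing move in rotated frames -/

/-- **Region of the hook**: the `ρ^i`-images of the spoke box, the annulus `{n ≤ |v| ≤ 2M}`, the zone
of the exit and the corner box, and the entry tube, all lie in `{n ≤ |v| ≤ 4M}` (for a middle tip, a window
below the tip row with `w + k/4 + 2ε ≤ k`, and `k + L ≤ 2M`, `n ≤ M`, `2k + 1 ≤ M`). [folklore] -/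
theorem hook_region {M n : ℕ} {i : ℕ} {z : Site 2} (hz : z ∈ trapO M) {k : ℕ} (hk1 : 2 * (k : ℤ) + 1 ≤ M)
    (hz4 : z 1 + 4 * k + 2 ≤ 0) {T₀ : ℤ} {w L ε : ℕ} (hwin : T₀ ≤ z 1 ∧ z 1 < T₀ + w) (hT₀ : -(2 * (M : ℤ)) ≤ T₀)
    (hfit : (w : ℤ) + (k / 4 : ℕ) + 2 * ε ≤ k) (hkL : (k : ℤ) + L ≤ 2 * M) (hnM : n ≤ M)
    {Te : Tube} (hTe : Te.box ⊆ triAnnulusSet n (4 * M)) :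
    (triRotIsoPow i '' ((extSpokeTube M k T₀ w L ε).box ∪
        (triAnnSet n (2 * M) ∪ trapExitZone M z k ∪ triStrip (z 0 + k) (z 1 + k) k k)) ∪ Te.box) ⊆ triAnnulusSet n (4 * M) := by
  obtain ⟨hz0, hz1lo, -⟩ := trapO_coord hz
  have hnM' : (n : ℤ) ≤ M := by exact_mod_cast hnM
  rintro v (⟨u, hu, rfl⟩ | hv)
  · rw [mem_triAnnulusSet, triNorm_rot]
    push_cast
    rcases hu with hu | (hu | hu) | hu
    · rw [Tube.mem_box] at hu; simp only [extSpokeTube] at hu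
      have hk4 : (0 : ℤ) ≤ (k / 4 : ℕ) := by positivity
      have hn : triNorm u = u 0 :=
        le_antisymm (triNorm_le_iff_lin.2 (by omega)) (le_triNorm_iff_lin.2 (Or.inl le_rfl))
      rw [hn]; constructor <;> omega
    · rw [mem_triAnnSet] at hu; push_cast at hu; exact ⟨hu.1, by omega⟩
    · rw [mem_trapExitZone] at hu
      obtain ⟨h1, h2, h3, h4, h5⟩ := hu
      rcases h1 with h1 | h1
      · rw [mem_trapD_iff_triNorm] at h1
        exact ⟨(le_triNorm_iff_lin.2 (Or.inl (by omega))), by omega⟩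
      · constructor
        · exact le_trans (by omega) h1.le
        · exact triNorm_le_iff_lin.2 (by omega)
    · rw [mem_triStrip] at hu
      constructor
      · exact le_triNorm_iff_lin.2 (Or.inl (by omega))
      · exact triNorm_le_iff_lin.2 (by omega)
  · exact hTe hv

/-- **The landing move of a fenced exit read through `ρ^i`, to the RIGHT side of `∂Λ_{4M}` at a
middle target row `t`** (as `out_landing_move_row`, with the rotation hook `trapExit_to_entry` and
the spoke `extSpokeTube`): on the spoke, the arc (containing the entry tube met by the spoke and the
run `V_{j₀..j₀+d}` across the rows `[t, t + 4M/64]`), the approach tube and the thinned target free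
space, `ω ∈ extOpenArm n (4M)`. [cite: Nolin2008, §4.3 Prop. 12 and §4.4 (arXiv 0711.4948: Prop. 11, Thm. 10, p. 12)] -/
theorem rot_exit_landing_move_row' {M n k₀ K R₀ : ℕ} (hnM : n ≤ M) {i : ℕ} (hi : i < 6) {ω : SiteConfig (Site 2)}
    (F : TrapExit M n k₀ K (rotConfig i ω)) (hmid : -(2 * (M : ℤ)) + R₀ ≤ F.z 1 ∧ F.z 1 ≤ -(R₀ : ℤ))
    (hR : 4 * F.k + 2 ≤ R₀) (hkM : 2 * (F.k : ℤ) + 1 ≤ M)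
    {T₀ : ℤ} {w : ℕ} (hwin : T₀ ≤ F.z 1 ∧ F.z 1 < T₀ + w) (hT₀ : -(2 * (M : ℤ)) ≤ T₀)
    {L ε : ℕ} (hfit : (w : ℤ) + (F.k / 4 : ℕ) + 2 * ε ≤ F.k) (hL : F.k + 1 ≤ L) (hSp : ω ∈ extSpokeEvent i M F.k T₀ w L ε)
    {r e s a len : ℕ} (hs : 1 ≤ s) (hsr : s ∣ r) (hsr' : s ≤ r) (he : 2 * e ≤ r)
    (harc : ω ∈ eventAll (arc (thinRing r e s) a len))
    {Te : Tube} (hTe : Te ∈ arc (thinRing r e s) a len) (hJ : SpokeMeetsRot i (extSpokeTube M F.k T₀ w L ε) Te)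
    {t : ℤ} (ht : -(2 * (M : ℤ)) + (4 * M / 16 : ℕ) ≤ t ∧ t ≤ -(M : ℤ) - (4 * M / 16 : ℕ))
    {j₀ d : ℕ} (hSL : ∀ T ∈ vchunks r (-(r : ℤ)) e s j₀ (d + 1), T ∈ arc (thinRing r e s) a len)
    (hlo : -(r : ℤ) + j₀ * s - e ≤ t) (hhi : t + (4 * M / 64 : ℕ) ≤ -(r : ℤ) + (j₀ + d) * s - e)
    {W : ℕ} (hW : (r : ℤ) - 2 * e + W = 4 * M + (4 * M / 16 : ℕ))
    (hH : ω ∈ triHCross ((r : ℤ) - 2 * e) t W (4 * M / 64)) (hV : ω ∈ otgtV (4 * M) t)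
    (hM : 64 ≤ M) (hkL : (F.k : ℤ) + L ≤ 2 * M) (hr2 : 2 * (M : ℤ) < (r : ℤ) - s - 2 * e) (hr4 : (r : ℤ) + 2 * e ≤ 4 * M) :
    ω ∈ extOpenArm n (4 * M) := by
  have hR' : 4 * (F.k : ℤ) + 2 ≤ R₀ := by exact_mod_cast hR
  have hnM' : (n : ℤ) ≤ M := by exact_mod_cast hnM
  obtain ⟨hz0, hz1, hz2⟩ := trapO_coord F.z_mem
  obtain ⟨hm1, hm2⟩ := hmid
  have ht4 : F.z 1 + 4 * F.k + 2 ≤ 0 := by omega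
  obtain ⟨hland, htr1, htr2⟩ := tgtRow_facts ht
  -- the arc as a nonempty chain with prescribed crossings
  obtain ⟨E, L', hEL⟩ := List.exists_cons_of_ne_nil (List.ne_nil_of_mem hTe)
  have harc' : ∀ T ∈ E :: L', ω ∈ T.event := fun T hT => harc T (hEL ▸ hT)
  have hch : List.IsChain Crosses (E :: L') := hEL ▸ isChain_arc_thinRing hs hsr hsr' a len
  obtain ⟨X, Y, hXY⟩ := exists_crossings harc'
  have hTe' : Te ∈ E :: L' := hEL ▸ hTe
  have hring : ∀ T ∈ E :: L', T ∈ thinRing r e s := fun T hT => mem_of_mem_arc (hEL ▸ hT : T ∈ arc (thinRing r e s) a len)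
  have hLreg : ∀ T ∈ E :: L', T.box ⊆ triAnnulusSet n (4 * M) := fun T hT v hv => by
    have := triNorm_mem_of_mem_thinRing he (hring T hT) hv
    rw [mem_triAnnulusSet]; push_cast; constructor <;> omega
  -- the hook
  have P₁ := trapExit_to_entry hi F hwin hfit hL hSp (hXY Te hTe') hJ
  -- everything lies in the annulus
  have hreg : (triRotIsoPow i '' ((extSpokeTube M F.k T₀ w L ε).box ∪
      (triAnnSet n (2 * M) ∪ trapExitZone M F.z F.k ∪ triStrip (F.z 0 + F.k) (F.z 1 + F.k) F.k F.k)) ∪ Te.box) ⊆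
      triAnnulusSet n (4 * M) ∪ triOpenBall ![((4 * M : ℕ) : ℤ), t] (4 * M / 8) :=
    (hook_region F.z_mem hkM ht4 hwin hT₀ hfit hkL hnM (hLreg Te hTe')).trans subset_union_left
  -- glue
  have hna : triNorm (triRotIsoPow i F.a) = n := by rw [triNorm_rot, F.norm_a]
  exact out_landing_glue (n := n) (N' := 4 * M) (t := t) ⟨htr1, htr2⟩ hland hch hXY hLreg
    hreg hTe' hna P₁ (fun T hT => hEL ▸ hSL T hT) hlo hhi (by omega) he (by push_cast; exact hW) hH hV (by omega)
    (by push_cast; omega)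

/-- **The landing move of a fenced exit read through `ρ^i`, to the TOP side of `∂Λ_{4M}`** (as
`out_landing_move_two`: the arc contains the TRANSPOSES of the run, the approach tube and the
thinned target free space are crossed by `frameConfig 2 ω`): `frameConfig 2 ω ∈ extOpenArm n (4M)`. [cite: Nolin2008, §4.3 Prop. 12 and §4.4 (arXiv 0711.4948: Prop. 11, Thm. 10, p. 12)] -/
theorem rot_exit_landing_move_two' {M n k₀ K R₀ : ℕ} (hnM : n ≤ M) {i : ℕ} (hi : i < 6) {ω : SiteConfig (Site 2)}
    (F : TrapExit M n k₀ K (rotConfig i ω)) (hmid : -(2 * (M : ℤ)) + R₀ ≤ F.z 1 ∧ F.z 1 ≤ -(R₀ : ℤ))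
    (hR : 4 * F.k + 2 ≤ R₀) (hkM : 2 * (F.k : ℤ) + 1 ≤ M)
    {T₀ : ℤ} {w : ℕ} (hwin : T₀ ≤ F.z 1 ∧ F.z 1 < T₀ + w) (hT₀ : -(2 * (M : ℤ)) ≤ T₀)
    {L ε : ℕ} (hfit : (w : ℤ) + (F.k / 4 : ℕ) + 2 * ε ≤ F.k) (hL : F.k + 1 ≤ L) (hSp : ω ∈ extSpokeEvent i M F.k T₀ w L ε)
    {r e s a len : ℕ} (hs : 1 ≤ s) (hsr : s ∣ r) (hsr' : s ≤ r) (he : 2 * e ≤ r)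
    (harc : ω ∈ eventAll (arc (thinRing r e s) a len))
    {Te : Tube} (hTe : Te ∈ arc (thinRing r e s) a len) (hJ : SpokeMeetsRot i (extSpokeTube M F.k T₀ w L ε) Te)
    {t : ℤ} (ht : -(2 * (M : ℤ)) + (4 * M / 16 : ℕ) ≤ t ∧ t ≤ -(M : ℤ) - (4 * M / 16 : ℕ))
    {j₀ d : ℕ} (hSL : ∀ T ∈ vchunks r (-(r : ℤ)) e s j₀ (d + 1), T.swap ∈ arc (thinRing r e s) a len)
    (hlo : -(r : ℤ) + j₀ * s - e ≤ t) (hhi : t + (4 * M / 64 : ℕ) ≤ -(r : ℤ) + (j₀ + d) * s - e)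
    {W : ℕ} (hW : (r : ℤ) - 2 * e + W = 4 * M + (4 * M / 16 : ℕ))
    (hH : frameConfig 2 ω ∈ triHCross ((r : ℤ) - 2 * e) t W (4 * M / 64)) (hV : frameConfig 2 ω ∈ otgtV (4 * M) t)
    (hM : 64 ≤ M) (hkL : (F.k : ℤ) + L ≤ 2 * M) (hr2 : 2 * (M : ℤ) < (r : ℤ) - s - 2 * e) (hr4 : (r : ℤ) + 2 * e ≤ 4 * M) :
    frameConfig 2 ω ∈ extOpenArm n (4 * M) := by
  have hR' : 4 * (F.k : ℤ) + 2 ≤ R₀ := by exact_mod_cast hR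
  have hnM' : (n : ℤ) ≤ M := by exact_mod_cast hnM
  obtain ⟨hz0, hz1, hz2⟩ := trapO_coord F.z_mem
  obtain ⟨hm1, hm2⟩ := hmid
  have ht4 : F.z 1 + 4 * F.k + 2 ≤ 0 := by omega
  obtain ⟨hland, htr1, htr2⟩ := tgtRow_facts ht
  -- the arc as a nonempty chain with prescribed crossings
  obtain ⟨E, L', hEL⟩ := List.exists_cons_of_ne_nil (List.ne_nil_of_mem hTe)
  have harc' : ∀ T ∈ E :: L', ω ∈ T.event := fun T hT => harc T (hEL ▸ hT)
  have hch : List.IsChain Crosses (E :: L') := hEL ▸ isChain_arc_thinRing hs hsr hsr' a len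
  obtain ⟨X, Y, hXY⟩ := exists_crossings harc'
  have hTe' : Te ∈ E :: L' := hEL ▸ hTe
  have hring : ∀ T ∈ E :: L', T ∈ thinRing r e s := fun T hT => mem_of_mem_arc (hEL ▸ hT : T ∈ arc (thinRing r e s) a len)
  have hLreg : ∀ T ∈ E :: L', T.box ⊆ triAnnulusSet n (4 * M) := fun T hT v hv => by
    have := triNorm_mem_of_mem_thinRing he (hring T hT) hv
    rw [mem_triAnnulusSet]; push_cast; constructor <;> omega
  -- the hook
  have P₁ := trapExit_to_entry hi F hwin hfit hL hSp (hXY Te hTe') hJ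
  -- everything lies in the (transposed) annulus
  have hreg0 := hook_region (i := i) F.z_mem hkM ht4 hwin hT₀ hfit hkL hnM (hLreg Te hTe')
  have hreg : (triRotIsoPow i '' ((extSpokeTube M F.k T₀ w L ε).box ∪
      (triAnnSet n (2 * M) ∪ trapExitZone M F.z F.k ∪ triStrip (F.z 0 + F.k) (F.z 1 + F.k) F.k F.k)) ∪ Te.box) ⊆
      frameIso 2 '' (triAnnulusSet n (4 * M) ∪ triOpenBall ![((4 * M : ℕ) : ℤ), t] (4 * M / 8)) := by
    intro v hv
    have h := hreg0 hv
    rw [mem_triAnnulusSet] at h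
    refine ⟨frameIso 2 v, Or.inl ⟨?_, ?_⟩, frameIso_two_two' v⟩
    · rw [triNorm_frameIso 2 (by norm_num)]; exact h.1
    · rw [triNorm_frameIso 2 (by norm_num)]; exact h.2
  -- glue, transposed
  have hna : triNorm (triRotIsoPow i F.a) = n := by rw [triNorm_rot, F.norm_a]
  exact out_landing_glue_two (n := n) (N' := 4 * M) (t := t) ⟨htr1, htr2⟩ hland hch hXY hLreg
    hreg hTe' hna P₁ (fun T hT => hEL ▸ hSL T hT) hlo hhi (by omega) he (by push_cast; exact hW) hH hV (by omega)
    (by push_cast; omega)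

/-- **The landing move to the right side, for a fenced exit** (`rot_exit_landing_move_row'` through
`TrapFencedExit.toTrapExit`). [cite: Nolin2008, §4.3 Prop. 12 and §4.4 (arXiv 0711.4948: Prop. 11, Thm. 10, p. 12)] -/
theorem rot_exit_landing_move_row {M n k₀ K R₀ : ℕ} (hnM : n ≤ M) {i : ℕ} (hi : i < 6) {ω : SiteConfig (Site 2)}
    (F : TrapFencedExit M n k₀ K (rotConfig i ω)) (hmid : -(2 * (M : ℤ)) + R₀ ≤ F.z 1 ∧ F.z 1 ≤ -(R₀ : ℤ))
    (hR : 4 * F.k + 2 ≤ R₀) (hkM : 2 * (F.k : ℤ) + 1 ≤ M)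
    {T₀ : ℤ} {w : ℕ} (hwin : T₀ ≤ F.z 1 ∧ F.z 1 < T₀ + w) (hT₀ : -(2 * (M : ℤ)) ≤ T₀)
    {L ε : ℕ} (hfit : (w : ℤ) + (F.k / 4 : ℕ) + 2 * ε ≤ F.k) (hL : F.k + 1 ≤ L) (hSp : ω ∈ extSpokeEvent i M F.k T₀ w L ε)
    {r e s a len : ℕ} (hs : 1 ≤ s) (hsr : s ∣ r) (hsr' : s ≤ r) (he : 2 * e ≤ r)
    (harc : ω ∈ eventAll (arc (thinRing r e s) a len))
    {Te : Tube} (hTe : Te ∈ arc (thinRing r e s) a len) (hJ : SpokeMeetsRot i (extSpokeTube M F.k T₀ w L ε) Te)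
    {t : ℤ} (ht : -(2 * (M : ℤ)) + (4 * M / 16 : ℕ) ≤ t ∧ t ≤ -(M : ℤ) - (4 * M / 16 : ℕ))
    {j₀ d : ℕ} (hSL : ∀ T ∈ vchunks r (-(r : ℤ)) e s j₀ (d + 1), T ∈ arc (thinRing r e s) a len)
    (hlo : -(r : ℤ) + j₀ * s - e ≤ t) (hhi : t + (4 * M / 64 : ℕ) ≤ -(r : ℤ) + (j₀ + d) * s - e)
    {W : ℕ} (hW : (r : ℤ) - 2 * e + W = 4 * M + (4 * M / 16 : ℕ))
    (hH : ω ∈ triHCross ((r : ℤ) - 2 * e) t W (4 * M / 64)) (hV : ω ∈ otgtV (4 * M) t)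
    (hM : 64 ≤ M) (hkL : (F.k : ℤ) + L ≤ 2 * M) (hr2 : 2 * (M : ℤ) < (r : ℤ) - s - 2 * e) (hr4 : (r : ℤ) + 2 * e ≤ 4 * M) :
    ω ∈ extOpenArm n (4 * M) :=
  rot_exit_landing_move_row' hnM hi F.toTrapExit hmid hR hkM hwin hT₀ hfit hL hSp hs hsr hsr' he harc hTe hJ ht hSL hlo hhi
    hW hH hV hM hkL hr2 hr4

/-- **The landing move to the top side, for a fenced exit** (`rot_exit_landing_move_two'` through
`TrapFencedExit.toTrapExit`). [cite: Nolin2008, §4.3 Prop. 12 and §4.4 (arXiv 0711.4948: Prop. 11, Thm. 10, p. 12)] -/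
theorem rot_exit_landing_move_two {M n k₀ K R₀ : ℕ} (hnM : n ≤ M) {i : ℕ} (hi : i < 6) {ω : SiteConfig (Site 2)}
    (F : TrapFencedExit M n k₀ K (rotConfig i ω)) (hmid : -(2 * (M : ℤ)) + R₀ ≤ F.z 1 ∧ F.z 1 ≤ -(R₀ : ℤ))
    (hR : 4 * F.k + 2 ≤ R₀) (hkM : 2 * (F.k : ℤ) + 1 ≤ M)
    {T₀ : ℤ} {w : ℕ} (hwin : T₀ ≤ F.z 1 ∧ F.z 1 < T₀ + w) (hT₀ : -(2 * (M : ℤ)) ≤ T₀)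
    {L ε : ℕ} (hfit : (w : ℤ) + (F.k / 4 : ℕ) + 2 * ε ≤ F.k) (hL : F.k + 1 ≤ L) (hSp : ω ∈ extSpokeEvent i M F.k T₀ w L ε)
    {r e s a len : ℕ} (hs : 1 ≤ s) (hsr : s ∣ r) (hsr' : s ≤ r) (he : 2 * e ≤ r)
    (harc : ω ∈ eventAll (arc (thinRing r e s) a len))
    {Te : Tube} (hTe : Te ∈ arc (thinRing r e s) a len) (hJ : SpokeMeetsRot i (extSpokeTube M F.k T₀ w L ε) Te)
    {t : ℤ} (ht : -(2 * (M : ℤ)) + (4 * M / 16 : ℕ) ≤ t ∧ t ≤ -(M : ℤ) - (4 * M / 16 : ℕ))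
    {j₀ d : ℕ} (hSL : ∀ T ∈ vchunks r (-(r : ℤ)) e s j₀ (d + 1), T.swap ∈ arc (thinRing r e s) a len)
    (hlo : -(r : ℤ) + j₀ * s - e ≤ t) (hhi : t + (4 * M / 64 : ℕ) ≤ -(r : ℤ) + (j₀ + d) * s - e)
    {W : ℕ} (hW : (r : ℤ) - 2 * e + W = 4 * M + (4 * M / 16 : ℕ))
    (hH : frameConfig 2 ω ∈ triHCross ((r : ℤ) - 2 * e) t W (4 * M / 64)) (hV : frameConfig 2 ω ∈ otgtV (4 * M) t)
    (hM : 64 ≤ M) (hkL : (F.k : ℤ) + L ≤ 2 * M) (hr2 : 2 * (M : ℤ) < (r : ℤ) - s - 2 * e) (hr4 : (r : ℤ) + 2 * e ≤ 4 * M) :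
    frameConfig 2 ω ∈ extOpenArm n (4 * M) :=
  rot_exit_landing_move_two' hnM hi F.toTrapExit hmid hR hkM hwin hT₀ hfit hL hSp hs hsr hsr' he harc hTe hJ ht hSL hlo hhi
    hW hH hV hM hkL hr2 hr4

end Literature.Probability.Percolation
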